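import Mathlib
import HarnessLib

/-!
# Stub `stub_seedObstruction` of line `birth` — helper 2: the resonance branch `z₁ = s²`, `z₂ = 1
      + γ s`
(crux `HiddenChargeMazur.DressedCharge`, item stmt-AtomisticToContinuum-13509; `--supports` helper)

Bivariate-polynomial bookkeeping for the seed obstruction, in `ℂ[X][Y]` with inner variable
`X = γ` and outer variable `Y = s` (`Polynomial.evalEval γ s`):
* `seed_evalEval_eq_zero`, `seed_branch_ext`: a bivariate polynomial vanishing on `ℂ²` is zero;
  two polynomials agreeing off `s (1 + γ s) = 0` agree after multiplication by `Y (1 + C X · Y)`;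
* trailing coefficients (in `s`, valued in `ℂ[γ]`): powers, constants, the units `Y`, `1
      + C X Y`, and
  "lowest nonzero coefficient";
* "branch polynomiality" `∃ M M' P, F(s,γ) s^M (1+γs)^{M'} = P(γ,s)` on `s ≠ 0, 1 + γ s ≠ 0`:
  closure under ring operations, the atoms `s, γ, s⁻², (1+γs)⁻¹`, and Laurent
  functions of `(z₁, z₂) = (s², 1 + γ s)`;
* `seed_exists_branchE`: `s⁸ (1+γs)⁴ E₃(ω̃(s²(1+γs)), ω̃(s²), ω̃(1+γs), ω₂) = s⁴ · E₁(γ, s)` for an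
  explicit `E₁ ∈ ℂ[X][Y]` with constant-in-`s` coefficient `γ⁴ + 16 ω₂ γ²` — the tangent cone of
  the four-phonon resonance variety at `(z₁, z₂) = (0, 1)` in the weighted chart.
No new definitions.
-/

noncomputable section

namespace Summit.AtomisticToContinuum.FouriersLaw.Theorems.DressedCharge

open Polynomial
open scoped Polynomial.Bivariate

/-! ## Bivariate polynomials as functions -/

/-- A bivariate complex polynomial vanishing at every point is zero. -/
theorem seed_evalEval_eq_zero {P : ℂ[X][Y]} (h : ∀ γ s : ℂ, P.evalEval γ s = 0) : P = 0 := by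
  have h1 : ∀ γ : ℂ, P.map (evalRingHom γ) = 0 := fun γ =>
    Polynomial.funext fun s => by rw [map_evalRingHom_eval, h, eval_zero]
  ext n : 1
  refine Polynomial.funext fun γ => ?_
  have := congrArg (fun q : ℂ[X] => q.coeff n) (h1 γ)
  simpa only [coeff_map, coe_evalRingHom, coeff_zero, eval_zero] using this

/-- Two bivariate polynomials that agree (as functions of `(γ, s)`) off `s (1 + γ s) = 0` agree
after multiplication by `Y · (1 + C X · Y)`. -/
theorem seed_branch_ext {P Q : ℂ[X][Y]}
    (h : ∀ s γ : ℂ, s ≠ 0 → 1 + γ * s ≠ 0 → P.evalEval γ s = Q.evalEval γ s) :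
    P * (Y ^ 1 * (1 + C X * Y) ^ 1) = Q * (Y ^ 1 * (1 + C X * Y) ^ 1) := by
  rw [← sub_eq_zero, ← sub_mul]
  refine seed_evalEval_eq_zero fun γ s => ?_
  simp only [evalEval_mul, evalEval_sub, evalEval_add, evalEval_one, evalEval_X, evalEval_C, eval_X,
    pow_one]
  by_cases hs : s = 0
  · simp [hs]
  by_cases h1 : 1 + γ * s = 0
  · simp [h1]
  simp [h s γ hs h1]

/-! ## Trailing coefficients in `s` -/

/-- `trailingCoeff` is multiplicative on powers (the coefficient ring `ℂ[γ]` is a domain). -/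
theorem seed_trailingCoeff_pow (P : ℂ[X][Y]) (n : ℕ) :
    (P ^ n).trailingCoeff = P.trailingCoeff ^ n := by
  induction n with
  | zero => rw [pow_zero, pow_zero, trailingCoeff, natTrailingDegree_one, coeff_one_zero]
  | succ n ih => rw [pow_succ, trailingCoeff_mul, ih, pow_succ]

/-- The trailing coefficient of a constant (in `s`) is the constant. -/
theorem seed_trailingCoeff_C (a : ℂ[X]) : (C a : ℂ[X][Y]).trailingCoeff = a := by
  rw [trailingCoeff, natTrailingDegree_C, coeff_C_zero]

/-- The unit factor `s` has trailing coefficient `1` (anchor of this helper file). -/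
theorem seed_trailingCoeff_Y : (Polynomial.X : Polynomial (Polynomial ℂ)).trailingCoeff = 1 := by
  rw [trailingCoeff, natTrailingDegree_X, coeff_X_one]

/-- The unit factor `1 + γ s` has trailing coefficient `1`. -/
theorem seed_trailingCoeff_L : (1 + C X * Y : ℂ[X][Y]).trailingCoeff = 1 := by
  have h0 : (1 + C X * Y : ℂ[X][Y]).coeff 0 = 1 := by simp
  rw [trailingCoeff_eq_coeff_zero (by rw [h0]; exact one_ne_zero), h0]

/-- If the coefficients below `n` vanish and the `n`-th does not, the trailing coefficient is
the `n`-th coefficient. -/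
theorem seed_trailingCoeff_of_coeff {P : ℂ[X][Y]} {n : ℕ} (h0 : ∀ m < n, P.coeff m = 0)
    (hn : P.coeff n ≠ 0) : P.trailingCoeff = P.coeff n := by
  have hP : P ≠ 0 := fun h => hn (by rw [h, coeff_zero])
  have : P.natTrailingDegree = n :=
    le_antisymm (natTrailingDegree_le_of_ne_zero hn) (le_natTrailingDegree hP h0)
  rw [trailingCoeff, this]

/-! ## Branch polynomiality -/

/-- Constants are branch-polynomial. -/
theorem seed_br_const (c : ℂ) :
    ∃ (M M' : ℕ) (P : Polynomial (Polynomial ℂ)), ∀ s γ : ℂ, s ≠ 0 → 1 + γ * s ≠ 0 →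
        c * s ^ M * (1 + γ * s) ^ M' = P.evalEval γ s :=
  ⟨0, 0, C (C c), fun s γ _ _ => by simp⟩

/-- Sums of branch-polynomial functions are branch-polynomial. -/
theorem seed_br_add {F G : ℂ → ℂ → ℂ}
    (hF : ∃ (M M' : ℕ) (P : Polynomial (Polynomial ℂ)), ∀ s γ : ℂ, s ≠ 0 → 1 + γ * s ≠ 0 →
        F s γ * s ^ M * (1 + γ * s) ^ M' = P.evalEval γ s)
    (hG : ∃ (M M' : ℕ) (P : Polynomial (Polynomial ℂ)), ∀ s γ : ℂ, s ≠ 0 → 1 + γ * s ≠ 0 →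
        G s γ * s ^ M * (1 + γ * s) ^ M' = P.evalEval γ s) :
    ∃ (M M' : ℕ) (P : Polynomial (Polynomial ℂ)), ∀ s γ : ℂ, s ≠ 0 → 1 + γ * s ≠ 0 →
        (F s γ + G s γ) * s ^ M * (1 + γ * s) ^ M' = P.evalEval γ s := by
  obtain ⟨M, M', P, hP⟩ := hF
  obtain ⟨L, L', Q, hQ⟩ := hG
  refine ⟨M + L, M' + L', P * (Y ^ L * (1 + C X * Y) ^ L') + Q * (Y ^ M * (1 + C X * Y) ^ M'),
    fun s γ hs h1 => ?_⟩
  simp only [evalEval_add, evalEval_mul, evalEval_pow, evalEval_one, evalEval_X, evalEval_C, eval_X,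
    ← hP s γ hs h1, ← hQ s γ hs h1]
  ring

/-- Products of branch-polynomial functions are branch-polynomial. -/
theorem seed_br_mul {F G : ℂ → ℂ → ℂ}
    (hF : ∃ (M M' : ℕ) (P : Polynomial (Polynomial ℂ)), ∀ s γ : ℂ, s ≠ 0 → 1 + γ * s ≠ 0 →
        F s γ * s ^ M * (1 + γ * s) ^ M' = P.evalEval γ s)
    (hG : ∃ (M M' : ℕ) (P : Polynomial (Polynomial ℂ)), ∀ s γ : ℂ, s ≠ 0 → 1 + γ * s ≠ 0 →
        G s γ * s ^ M * (1 + γ * s) ^ M' = P.evalEval γ s) :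
    ∃ (M M' : ℕ) (P : Polynomial (Polynomial ℂ)), ∀ s γ : ℂ, s ≠ 0 → 1 + γ * s ≠ 0 →
        (F s γ * G s γ) * s ^ M * (1 + γ * s) ^ M' = P.evalEval γ s := by
  obtain ⟨M, M', P, hP⟩ := hF
  obtain ⟨L, L', Q, hQ⟩ := hG
  refine ⟨M + L, M' + L', P * Q, fun s γ hs h1 => ?_⟩
  simp only [evalEval_mul, ← hP s γ hs h1, ← hQ s γ hs h1]
  ring

/-- Differences of branch-polynomial functions are branch-polynomial. -/
theorem seed_br_sub {F G : ℂ → ℂ → ℂ}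
    (hF : ∃ (M M' : ℕ) (P : Polynomial (Polynomial ℂ)), ∀ s γ : ℂ, s ≠ 0 → 1 + γ * s ≠ 0 →
        F s γ * s ^ M * (1 + γ * s) ^ M' = P.evalEval γ s)
    (hG : ∃ (M M' : ℕ) (P : Polynomial (Polynomial ℂ)), ∀ s γ : ℂ, s ≠ 0 → 1 + γ * s ≠ 0 →
        G s γ * s ^ M * (1 + γ * s) ^ M' = P.evalEval γ s) :
    ∃ (M M' : ℕ) (P : Polynomial (Polynomial ℂ)), ∀ s γ : ℂ, s ≠ 0 → 1 + γ * s ≠ 0 →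
        (F s γ - G s γ) * s ^ M * (1 + γ * s) ^ M' = P.evalEval γ s := by
  obtain ⟨M, M', P, hP⟩ := hF
  obtain ⟨L, L', Q, hQ⟩ := hG
  refine ⟨M + L, M' + L', P * (Y ^ L * (1 + C X * Y) ^ L') - Q * (Y ^ M * (1 + C X * Y) ^ M'),
    fun s γ hs h1 => ?_⟩
  simp only [evalEval_sub, evalEval_mul, evalEval_pow, evalEval_one, evalEval_X, evalEval_C, eval_X,
    evalEval_add, ← hP s γ hs h1, ← hQ s γ hs h1]
  ring

/-- Powers of branch-polynomial functions are branch-polynomial. -/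
theorem seed_br_pow {F : ℂ → ℂ → ℂ}
    (hF : ∃ (M M' : ℕ) (P : Polynomial (Polynomial ℂ)), ∀ s γ : ℂ, s ≠ 0 → 1 + γ * s ≠ 0 →
        F s γ * s ^ M * (1 + γ * s) ^ M' = P.evalEval γ s) (n : ℕ) :
    ∃ (M M' : ℕ) (P : Polynomial (Polynomial ℂ)), ∀ s γ : ℂ, s ≠ 0 → 1 + γ * s ≠ 0 →
        F s γ ^ n * s ^ M * (1 + γ * s) ^ M' = P.evalEval γ s := by
  induction n with
  | zero => simpa using seed_br_const 1
  | succ n ih => simpa [pow_succ] using seed_br_mul ih hF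

/-- `s` is branch-polynomial. -/
theorem seed_br_s :
    ∃ (M M' : ℕ) (P : Polynomial (Polynomial ℂ)), ∀ s γ : ℂ, s ≠ 0 → 1 + γ * s ≠ 0 →
        s * s ^ M * (1 + γ * s) ^ M' = P.evalEval γ s :=
  ⟨0, 0, Y, fun s γ _ _ => by simp⟩

/-- `γ` is branch-polynomial. -/
theorem seed_br_γ :
    ∃ (M M' : ℕ) (P : Polynomial (Polynomial ℂ)), ∀ s γ : ℂ, s ≠ 0 → 1 + γ * s ≠ 0 →
        γ * s ^ M * (1 + γ * s) ^ M' = P.evalEval γ s :=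
  ⟨0, 0, C X, fun s γ _ _ => by simp [evalEval_C]⟩

/-- `s⁻²` is branch-polynomial. -/
theorem seed_br_inv_sq :
    ∃ (M M' : ℕ) (P : Polynomial (Polynomial ℂ)), ∀ s γ : ℂ, s ≠ 0 → 1 + γ * s ≠ 0 →
        (s ^ 2)⁻¹ * s ^ M * (1 + γ * s) ^ M' = P.evalEval γ s :=
  ⟨2, 0, 1, fun s γ hs _ => by simp [hs]⟩

/-- `(1 + γ s)⁻¹` is branch-polynomial. -/
theorem seed_br_inv_lin :
    ∃ (M M' : ℕ) (P : Polynomial (Polynomial ℂ)), ∀ s γ : ℂ, s ≠ 0 → 1 + γ * s ≠ 0 →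
        (1 + γ * s)⁻¹ * s ^ M * (1 + γ * s) ^ M' = P.evalEval γ s :=
  ⟨0, 1, 1, fun s γ _ h1 => by simp [h1]⟩

/-- Pulling a bivariate `MvPolynomial` back to the branch `(z₁, z₂) = (s², 1 + γ s)`. -/
theorem seed_evalEval_branch (p : MvPolynomial (Fin 2) ℂ) (s γ : ℂ) :
    (MvPolynomial.eval₂ (Polynomial.C.comp Polynomial.C) ![(Y : ℂ[X][Y]) ^ 2, 1 + C X
          * Y] p).evalEval
      γ s = MvPolynomial.eval ![s ^ 2, 1 + γ * s] p := by
  induction p using MvPolynomial.induction_on with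
  | C c => simp
  | add p q hp hq => simp only [MvPolynomial.eval₂_add, evalEval_add, hp, hq, map_add]
  | mul_X p i hp =>
    fin_cases i
    · simp only [MvPolynomial.eval₂_mul, MvPolynomial.eval₂_X, evalEval_mul, hp, map_mul,
        MvPolynomial.eval_X, Fin.zero_eta, Fin.isValue, Matrix.cons_val_zero, evalEval_pow, evalEval_X]
    · simp only [MvPolynomial.eval₂_mul, MvPolynomial.eval₂_X, evalEval_mul, hp, map_mul,
        MvPolynomial.eval_X, Fin.mk_one, Fin.isValue, Matrix.cons_val_one, Matrix.cons_val_fin_one,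
        evalEval_add, evalEval_one, evalEval_C, evalEval_X, eval_X]

/-- A Laurent function of `(z₁, z₂)` is branch-polynomial along `(z₁, z₂) = (s², 1 + γ s)`. -/
theorem seed_br_of_laurent {f : ℂ → ℂ → ℂ}
    (hf : ∃ (N : ℕ) (p : MvPolynomial (Fin 2) ℂ), ∀ z₁ z₂ : ℂ, z₁ ≠ 0 → z₂ ≠ 0 →
        f z₁ z₂ * (z₁ * z₂) ^ N = MvPolynomial.eval ![z₁, z₂] p) :
    ∃ (M M' : ℕ) (P : Polynomial (Polynomial ℂ)), ∀ s γ : ℂ, s ≠ 0 → 1 + γ * s ≠ 0 →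
        f (s ^ 2) (1 + γ * s) * s ^ M * (1 + γ * s) ^ M' = P.evalEval γ s := by
  obtain ⟨N, p, hp⟩ := hf
  refine ⟨2 * N, N, MvPolynomial.eval₂ (Polynomial.C.comp Polynomial.C) ![(Y : ℂ[X][Y]) ^ 2, 1 + C X
        * Y] p,
    fun s γ hs h1 => ?_⟩
  rw [seed_evalEval_branch, ← hp (s ^ 2) (1 + γ * s) (pow_ne_zero 2 hs) h1, mul_pow, ← pow_mul]
  ring

/-! ## The resonance quartic along the branch -/

/-- **Tangent cone of the resonance variety.** There is `E₁ ∈ ℂ[γ][s]` with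
`E₁(γ, s) = s⁴ (1 + γ s)⁴ · E₃(ω̃(s²(1+γs)), ω̃(s²), ω̃(1+γs), ω₂)` for `s ≠ 0`, `1 + γ s ≠ 0`
(so `s⁸(1+γs)⁴ E₃ = s⁴ E₁`) and lowest coefficient `E₁(γ, 0) = γ⁴ + 16 ω₂ γ²`. Construction:
with `k = s²(1+γs)`, homogeneity gives `k⁴ E₃
      = E₃(k ω̃(k), k ω̃(s²), k ω̃(1+γs), k ω₂) =: E₃(A, B, s²C₁, s²D₁)`
with `A - B = γ s · e` (`e = 1 - s⁴ - γ s⁵`), and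
`E₃ = ((A-B)² - 2(A+B)(C+D) + (C-D)²)² - 64ABCD = s⁴ · (Q₁² - 64 A B C₁ D₁)`,
`Q₁ = γ² e² - 2(A+B)(C₁+D₁) + s²(C₁-D₁)²`. -/
theorem seed_exists_branchE (ω₂ : ℝ) :
    ∃ E₁ : ℂ[X][Y], E₁.coeff 0 = X ^ 4 + C (16 * (ω₂ : ℂ)) * X ^ 2 ∧
      ∀ s γ : ℂ, s ≠ 0 → 1 + γ * s ≠ 0 → ∀ w₁ w₂ w₁₂ : ℂ,
        w₁ = ((ω₂ : ℂ) + 2 - (s ^ 2) - (s ^ 2)⁻¹) → w₂ = ((ω₂ : ℂ) + 2 - (1 + γ * s) - (1 + γ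
              * s)⁻¹) →
        w₁₂ = (ω₂ : ℂ) + 2 - (s ^ 2 * (1 + γ * s)) - (s ^ 2 * (1 + γ * s))⁻¹ →
        E₁.evalEval γ s = s ^ 4 * (1 + γ * s) ^ 4 *
          ((w₁₂ ^ 2 + w₁ ^ 2 + w₂ ^ 2 + (ω₂ : ℂ) ^ 2 - 2 * (w₁₂ * w₁ + w₁₂ * w₂ + w₁₂ * (ω₂ : ℂ)
                + w₁ * w₂ + w₁ * (ω₂ : ℂ) + w₂ * (ω₂ : ℂ))) ^ 2 - 64 * w₁₂ * w₁ * w₂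
                * (ω₂ : ℂ)) := by
  refine ⟨(C X ^ 2 * (1 - Y ^ 4 - C X * Y ^ 5) ^ 2
      - 2 * ((C (C ((ω₂ : ℂ) + 2)) * Y ^ 2 * (1 + C X * Y) - Y ^ 4 * (1 + C X * Y) ^ 2 - 1)
          + (1 + C X * Y) * (C (C ((ω₂ : ℂ) + 2)) * Y ^ 2 - Y ^ 4 - 1))
        * ((C (C ((ω₂ : ℂ) + 2)) * (1 + C X * Y) - (1 + C X * Y) ^ 2 - 1) + C (C (ω₂ : ℂ)) * (1
              + C X * Y))
      + Y ^ 2 * ((C (C ((ω₂ : ℂ) + 2)) * (1 + C X * Y) - (1 + C X * Y) ^ 2 - 1)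
          - C (C (ω₂ : ℂ)) * (1 + C X * Y)) ^ 2) ^ 2
    - 64 * (C (C ((ω₂ : ℂ) + 2)) * Y ^ 2 * (1 + C X * Y) - Y ^ 4 * (1 + C X * Y) ^ 2 - 1)
      * ((1 + C X * Y) * (C (C ((ω₂ : ℂ) + 2)) * Y ^ 2 - Y ^ 4 - 1))
      * (C (C ((ω₂ : ℂ) + 2)) * (1 + C X * Y) - (1 + C X * Y) ^ 2 - 1) * (C (C (ω₂ : ℂ)) * (1 + C X
            * Y)),
    ?_, fun s γ hs h1 w₁ w₂ w₁₂ hw₁ hw₂ hw₁₂ => ?_⟩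
  · simp only [coeff_zero_eq_eval_zero, eval_sub, eval_mul, eval_pow, eval_add, eval_C, eval_X, eval_one,
      eval_ofNat]
    simp only [map_add, map_mul, map_ofNat]
    ring
  have hk : s ^ 2 * (1 + γ * s) ≠ 0 := mul_ne_zero (pow_ne_zero 2 hs) h1
  have hA : s ^ 2 * (1 + γ * s) * w₁₂ =
      ((ω₂ : ℂ) + 2) * (s ^ 2 * (1 + γ * s)) - (s ^ 2 * (1 + γ * s)) ^ 2 - 1 := by
    rw [hw₁₂]; linear_combination (-1 : ℂ) * mul_inv_cancel₀ hk
  have hB : s ^ 2 * (1 + γ * s) * w₁ = (1 + γ * s) * (((ω₂ : ℂ) + 2) * s ^ 2 - (s ^ 2) ^ 2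
        - 1) := by
    rw [hw₁]; linear_combination (-(1 + γ * s)) * mul_inv_cancel₀ (pow_ne_zero 2 hs)
  have hC : s ^ 2 * (1 + γ * s) * w₂ =
      s ^ 2 * (((ω₂ : ℂ) + 2) * (1 + γ * s) - (1 + γ * s) ^ 2 - 1) := by
    rw [hw₂]; linear_combination (-(s ^ 2)) * mul_inv_cancel₀ h1
  have hom : ∀ T A B D k : ℂ, k ^ 4 * ((T ^ 2 + A ^ 2 + B ^ 2 + D ^ 2 - 2 * (T * A + T * B + T * D
        + A * B + A * D + B * D)) ^ 2 - 64 * T * A * B * D) = (((k * T) ^ 2 + (k * A) ^ 2 + (k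
        * B) ^ 2 + (k * D) ^ 2 - 2 * ((k * T) * (k * A) + (k * T) * (k * B) + (k * T) * (k * D) + (k
        * A) * (k * B) + (k * A) * (k * D) + (k * B) * (k * D))) ^ 2 - 64 * (k * T) * (k * A) * (k
        * B) * (k * D)) := by
    intro T A B D k; ring
  simp only [evalEval, eval_C, eval_X, eval_ofNat, eval_mul, eval_pow, eval_sub, eval_add, eval_one]
  refine mul_left_cancel₀ (pow_ne_zero 4 hs) ?_
  conv_rhs => rw [← mul_assoc, ← mul_assoc,
    show s ^ 4 * s ^ 4 * (1 + γ * s) ^ 4 = (s ^ 2 * (1 + γ * s)) ^ 4 by ring, hom, hA, hB, hC]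
  ring

end Summit.AtomisticToContinuum.FouriersLaw.Theorems.DressedCharge
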